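import Summits.BirchSwinnertonDyer.Rank1Residual.X4.UpNilpotentPartOfSemistableLevel
import Summits.BirchSwinnertonDyer.Rank1Residual.X4.UpNilpotentProjector
import Summits.BirchSwinnertonDyer.Rank1Residual.X4.UpOldProjector
import Summits.BirchSwinnertonDyer.Rank1Residual.X4.SaturationSplitsAlongProjector
import Summits.BirchSwinnertonDyer.Rank1Residual.X4.AtkinLehnerRibetIdentity
import HarnessLib

/-!
# T-V54 at the semistable level from the `p`-minimal level: PROPOSITION V64-B as ONE kernel theorem per case, with only Ribet's data displayed (cell `b2b-bsdres`, seat additive-p4 gen 42, line V64/V68/V70 — K124)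

HONEST FRAMING (verbatim, cell `b2b-bsdres`): the goal of the cell is to DELETE the COMBINATION-SHAPED
residual classes for ALL analytic-rank `≤ 1` curves over `ℚ` — "full BSD formula for every rank `≤ 1`
curve in class `C`" assembled STRICTLY from published theorems — so that the rank-`≤ 1` remainder
becomes exactly the CONSTRUCTION-SHAPED classes, which are TYPED (missing-input Props), NOT attempted;
this is not "finishing BSD". This file: TOOL theorems (pure module algebra; 0 defs, 0 facts, nothing
booked; X4 stays CONSTRUCTION-shaped; no mark moves).

## Why

The kernel chain of Proposition V64-B (memo V64 §3; THETA-ROWS-ENDSTATE §2 (a′)) — "T-V54 at the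
semistable level `(pM, 𝔪)` ⟺ T-V54 at the `p`-minimal level `(M, 𝔪)` ∧ T-V54 on the complement" — was
landed in pieces as the farm allowed: K114 `X4/UpNilpotentPartOfSemistableLevel` (the `U_p`-nilpotent
part is the bottom lattice, with Hensel's idempotent as five hypotheses), K115 (lattice clause), K118a
`X4/UpNilpotentProjector` (the polynomial projector `e₀ = c • (U − u₁)(U² − 1)` from the two roots of
`X² − tX + p`; case (B2), `a_p(ρ̄) ≠ 0`; its docstring announces a companion file
`X4/UpNilpotentPartOfRoots.lean` (K118b) restating K114's headline with the idempotent, finiteness and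
Nakayama DISCHARGED — that companion is §0 OF THIS FILE, K118b having waited four generations on the
hub olean of K118a), K118c `X4/UpOldProjector`
(case (B1), `t² − (p+1)²` a unit, e.g. `a_p(ρ̄) = 0`), K118d `X4/SaturationSplitsAlongProjector`
(saturation splits along the projector), K120 `X4/AtkinLehnerRibetIdentity` (`hAL` at INTEGRAL strength
and convention (A) for the bridged pair `(U ∘ α^*, α^*)`, both from Ribet's printed identity
`U_p + w_p = α^* ∘ β_*`). This file COMPOSES them into ONE theorem per case whose displayed hypotheses
are EXACTLY the primitive list of memo V70 / V71-PLAN §C.1: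

* Ribet's data on `Y = H₁(X₀(pM), ℤ)_𝔪` with the geometric pair `d₁ = α^*`, `dₚ = −β^*` and `a = β_*`,
  `W = w_p`: `U y + W y = d₁ (a y)` [Ribet 1990, proof of Prop. 3.7, p. 446], the swap
  `W d₁ = −dₚ`, `W dₚ = −d₁` [`β = α ∘ w_p`, p. 445], `a ∘ d₁ = t` (`β_* α^* = T_p`),
  `a ∘ dₚ = −(p+1)` (`β_* β^* = deg β = p + 1`), `W² = 1`;
* injectivity of `d₁.coprod dₚ = α^* ⊕ (−β^*)` on `K × K`, `K = H₁(X₀(M), ℤ)_𝔪` (characteristic zero: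
  the two degeneracy images are independent — NOT Ihara);
* case (B2): the roots `u₀, u₁` of `X² − tX + p` with `u₁ − u₀`, `u₀² − 1` units (K118a
  `exists_roots_of_henselian`: the Henselian property of `𝕋(M)_𝔪`, `p ∈ 𝔪`, `t ∉ 𝔪`); case (B1): one
  unit `d`, `d · (t² − (p+1)²) = 1`;
* the two-prime old lattice `S ≤ Y` is `U_p`-stable, and the OLD-LATTICE IDENTIFICATION: in case (B2)
  `S ⊓ ker(U − u₀) = φ₀(S₀)` with `φ₀ = u₀ • d₁ + dₚ` K115's transpose intertwiner and `S₀ ≤ K` the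
  two-prime old lattice one level down; in case (B1) `S ⊓ range(d₁.coprod dₚ) = (d₁.coprod dₚ)(S₀ × S₀)`
  (K115 `oldLattice_inf_nilpotentPart_eq` reduces both to the commuting of the `ℓ_i`-degeneracies with
  the projector — a polynomial in `U_p` — and the same statement at level `pM/ℓ_i`; displayed here).

## What is proved

* §0 (= K118b) `K114_hypotheses_of_projector` — the five `e`-hypotheses of K114's
  `upNilpotentPart_eq_range_intertwiner` (`he`, `heU`, `he₀`, `he₁`, `hnil` with `n = 1` for any ideal
  `I ∋ u₀`) and `hN` hold for the explicit projector `e₀ := c • (U − u₁)(U² − 1)`,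
  `c · (u₀ − u₁)(u₀² − 1) = 1`; `upNilpotentPart_eq_range_intertwiner_of_roots` — PROPOSITION V64-B (B2)
  for `N := ker(U − u₀ • 1)` in convention (A): `N = range φ₀` (`φ₀ = d₁ + (u₀ − t) • dₚ`, injective),
  `U = u₀` on `N`, the saturation transfer `K ↔ N`, AND `IsCompl N (ker((U − u₁)(U² − 1)))` — from
  convention (A), the two roots with `u₁ − u₀`, `u₀² − 1` units, `hj` and `hAL`; NO finiteness of `Y`,
  NO idempotent, NO ideal `I ≤ Jac(R)` (checkpoint (i) is K118a's `ker_sub_le_range_coprod`, the rest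
  K114's `eigen_iff_mem_range_intertwiner` / `smul_mem_imp_iff_map_of_injective`).
* `smul_mem_imp_on_iff_of_inf_eq` — bookkeeping: if `S ⊓ N = P` then "`S` is `r`-saturated on `N`" iff
  "`P` is `r`-saturated on `N`".
* `prod_map_coprod_convA_eq` — the bridged pair `(U ∘ d₁, d₁)` maps `S₀ × S₀` onto the same lattice as
  the geometric pair (unimodular change of coordinates `(x, z) ↦ (t • x + z, x)`).
* `upNilpotentPart_of_ribetData` — case (B2) structure from Ribet's data: `ker(U − u₀) = range φ₀`,
  `φ₀ = u₀ • d₁ + dₚ` injective, `U = u₀` there, `Y = ker(U − u₀) ⊕ ker((U − u₁)(U² − 1))`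
  (K118b ∘ K120's bridge; K115's transpose intertwiner appears by `intertwiner_convA_eq_transpose`).
* `tv54_semistable_iff_minimal_caseB2` — **PROP. V64-B, case (B2), ONE THEOREM**: for `U`-stable `S`
  with the identification `S ⊓ ker(U − u₀) = φ₀(S₀)`:
  `S` is `r`-saturated in `Y` ⟺ `S₀` is `r`-saturated in `K` ∧ `S` is `r`-saturated on
  `ker((U − u₁)(U² − 1))` (T-V54 at the ordinary ideals `(𝔪, U_p − u₁)`, `(𝔪, U_p ∓ 1)`).
* `pOldPart_of_ribetData` — case (B1) structure from Ribet's data: `range(d₁.coprod dₚ) =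
  ker(U² − tU + p)`, `Y = ker(U² − tU + p) ⊕ ker(U² − 1)`.
* `tv54_semistable_iff_minimal_caseB1` — **PROP. V64-B, case (B1), ONE THEOREM**: with the
  identification `S ⊓ range(d₁.coprod dₚ) = (d₁.coprod dₚ)(S₀ × S₀)`:
  `S` is `r`-saturated in `Y` ⟺ `S₀` is `r`-saturated in `K` ∧ `S` is `r`-saturated on `ker(U² − 1)`
  (the `p`-new vectors at `𝔪`, `U_p = ±1` there).

No number theory enters. With K108 (devissage along the `p`-old filtration of level `p²M`) and K110
(the degeneracy trace) these are the (a′) arrows of THETA-ROWS-ENDSTATE §2; what they display is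
PUBLISHED (Ribet 1990 pp. 445–447; degrees of degeneracy maps), characteristic-zero linear algebra,
Mathlib's Henselian lemma / one unit, and the old-lattice identification.

## References (context only; the proofs are elementary)

* K. A. Ribet, Invent. Math. 100 (1990) 431–476, Remark 3.9 (p. 447) and proof of Prop. 3.7
  (pp. 445–446). [cite: Ribet1990, Remark 3.9 (p. 447) and Prop. 3.7 (proof), pp. 445–446]
* A. Wiles, Ann. of Math. 141 (1995), §2 (the `p`-old pair and `U_p`). [cite: Wiles1995, §2]
* K. Ribet, Proc. ICM 1983 (1984), Thm. 4.1 (Ihara's lemma — NOT used here; the identification of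
  the old lattices in the application is where it enters). [cite: Ribet1984ICM, Thm. 4.1]
-/

namespace Summit.BirchSwinnertonDyer.Rank1Residual.LevelLowering

/-! ## §0 (= K118b): Proposition V64-B (B2) from the two roots alone, convention (A) -/

section FromRoots

variable {R K Y : Type*} [CommRing R] [AddCommGroup K] [Module R K] [AddCommGroup Y] [Module R Y]

/-- **K114's five `e`-hypotheses DISCHARGED by the explicit projector** `e₀ := c • (U − u₁)(U² − 1)`:
idempotent, commutes with `U`, `1` on `φ₀(K)`, `0` on `φ₁(K)`, one step of nilpotence `U(e₀ y) ∈ I•⊤`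
for any ideal `I ∋ u₀` (so `hnil` with `n = 1`), and `Fix(e₀) = ker(U − u₀)`. [cite: Wiles1995, §2] -/
theorem K114_hypotheses_of_projector (t p u₀ u₁ : R) (hu₀ : u₀ * u₀ = t * u₀ - p)
    (hu₁ : u₁ * u₁ = t * u₁ - p) (hunit : IsUnit (u₁ - u₀)) (d₁ dₚ : K →ₗ[R] Y) (U : Y →ₗ[R] Y)
    (hU₁ : ∀ x, U (d₁ x) = d₁ (t • x) - p • dₚ x) (hUₚ : ∀ x, U (dₚ x) = d₁ x)
    (hAL : ∀ y, U (U y) - y ∈ LinearMap.range (d₁.coprod dₚ))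
    (c : R) (hc : c * ((u₀ - u₁) * (u₀ * u₀ - 1)) = 1) (I : Ideal R) (hI : u₀ ∈ I) :
    (∀ y, (c • ((U - u₁ • 1) * (U * U - 1))) ((c • ((U - u₁ • 1) * (U * U - 1))) y)
        = (c • ((U - u₁ • 1) * (U * U - 1))) y)
    ∧ (∀ y, (c • ((U - u₁ • 1) * (U * U - 1))) (U y) = U ((c • ((U - u₁ • 1) * (U * U - 1))) y))
    ∧ (∀ x, (c • ((U - u₁ • 1) * (U * U - 1))) ((d₁ + (u₀ - t) • dₚ) x) = (d₁ + (u₀ - t) • dₚ) x)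
    ∧ (∀ x, (c • ((U - u₁ • 1) * (U * U - 1))) ((d₁ + (u₁ - t) • dₚ) x) = 0)
    ∧ (∀ y, (U ^ 1) ((c • ((U - u₁ • 1) * (U * U - 1))) y)
        ∈ I • (⊤ : Submodule R Y) ⊔ LinearMap.range (d₁.coprod dₚ))
    ∧ (∀ y, y ∈ LinearMap.ker (U - u₀ • 1) ↔ (c • ((U - u₁ • 1) * (U * U - 1))) y = y) := by
  refine ⟨projector_idem t p u₀ u₁ hu₀ hu₁ hunit d₁ dₚ U hU₁ hUₚ hAL c hc,
    projector_comm u₁ c U,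
    projector_apply_intertwiner₀ t p u₀ u₁ hu₀ hu₁ hunit d₁ dₚ U hU₁ hUₚ hAL c hc,
    projector_apply_intertwiner₁ t p u₁ hu₁ d₁ dₚ U hU₁ hUₚ c, ?_, ?_⟩
  · intro y
    rw [pow_one, U_projector_apply t p u₀ u₁ hu₀ hu₁ hunit d₁ dₚ U hU₁ hUₚ hAL c y]
    exact Submodule.mem_sup_left (Submodule.smul_mem_smul hI Submodule.mem_top)
  · intro y
    rw [projector_apply_eq_self_iff t p u₀ u₁ hu₀ hu₁ hunit d₁ dₚ U hU₁ hUₚ hAL c hc y]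
    simp [sub_eq_zero]

/-- **PROPOSITION V64-B (B2) WITH HENSEL'S IDEMPOTENT DISCHARGED — the `U_p`-nilpotent part
`N := ker(U − u₀)` of the semistable level IS the bottom lattice, and `Y = N ⊕ Y^{u}`.**
HYPOTHESES: convention (A) `hU₁`/`hUₚ`; the two roots `u₀, u₁` of `X² − tX + p` with `u₁ − u₀` and
`u₀² − 1` units (`exists_roots_of_henselian`); `hj` = injectivity of `j′` (Ihara at `p ∤ M`, BY NAME in
the application); `hAL` (`U_p² = 1` on the `p`-new quotient). NO finiteness, NO idempotent, NO ideal.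
CONCLUSION: `N = range φ₀` (`φ₀ = d₁ + (u₀ − t) • dₚ`, injective), `U = u₀` on `N`, the saturation
transfer (`S ≤ K` is `r`-saturated iff `φ₀(S)` is `r`-saturated in `N` — T-V54 at
`(pM, 𝔪, U_p-nilpotent)` ⟺ T-V54 at `(M, 𝔪)` with K115's lattice clause), and the complement
`IsCompl N (ker((U − u₁)(U² − 1)))`. Research-route tool theorem; nothing booked.
[cite: Wiles1995, §2] [cite: Ribet1984ICM, Thm. 4.1] -/
theorem upNilpotentPart_eq_range_intertwiner_of_roots
    (t p u₀ u₁ : R) (hu₀ : u₀ * u₀ = t * u₀ - p) (hu₁ : u₁ * u₁ = t * u₁ - p)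
    (hunit : IsUnit (u₁ - u₀)) (hu₀1 : IsUnit (u₀ * u₀ - 1))
    (d₁ dₚ : K →ₗ[R] Y) (U : Y →ₗ[R] Y)
    (hU₁ : ∀ x, U (d₁ x) = d₁ (t • x) - p • dₚ x) (hUₚ : ∀ x, U (dₚ x) = d₁ x)
    (hj : Function.Injective (d₁.coprod dₚ))
    (hAL : ∀ y, U (U y) - y ∈ LinearMap.range (d₁.coprod dₚ)) :
    LinearMap.ker (U - u₀ • 1) = LinearMap.range (d₁ + (u₀ - t) • dₚ)
    ∧ Function.Injective (d₁ + (u₀ - t) • dₚ)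
    ∧ (∀ w ∈ LinearMap.ker (U - u₀ • 1), U w = u₀ • w)
    ∧ (∀ (r : R) (S : Submodule R K), ((∀ x : K, r • x ∈ S → x ∈ S) ↔
        (∀ w ∈ LinearMap.ker (U - u₀ • 1), r • w ∈ S.map (d₁ + (u₀ - t) • dₚ) →
          w ∈ S.map (d₁ + (u₀ - t) • dₚ))))
    ∧ IsCompl (LinearMap.ker (U - u₀ • 1)) (LinearMap.ker ((U - u₁ • 1) * (U * U - 1))) := by
  have hmem : ∀ y, y ∈ LinearMap.ker (U - u₀ • (1 : Module.End R Y)) ↔ U y = u₀ • y := fun y => by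
    simp [sub_eq_zero]
  have hNold := ker_sub_le_range_coprod u₀ hu₀1 d₁ dₚ U hAL
  have hNeq : LinearMap.ker (U - u₀ • 1) = LinearMap.range (d₁ + (u₀ - t) • dₚ) := by
    apply le_antisymm
    · intro y hy
      exact (eigen_iff_mem_range_intertwiner t p u₀ hu₀ d₁ dₚ U hU₁ hUₚ hj y (hNold hy)).mp
        ((hmem y).mp hy)
    · rintro y ⟨x, rfl⟩
      exact (hmem _).mpr (U_intertwiner_apply t p u₀ hu₀ d₁ dₚ U hU₁ hUₚ x)
  have hinj : Function.Injective (d₁ + (u₀ - t) • dₚ) := by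
    rw [intertwiner_eq_coprod_comp_graphMap]
    exact hj.comp (graphMap_injective (u₀ - t))
  have hunit' : IsUnit (u₀ - u₁) := by rw [← neg_sub]; exact hunit.neg
  obtain ⟨c, hc⟩ := (hunit'.mul hu₀1).exists_left_inv
  refine ⟨hNeq, hinj, fun w hw => (hmem w).mp hw, ?_,
    isCompl_ker_sub_ker_cubic t p u₀ u₁ hu₀ hu₁ hunit d₁ dₚ U hU₁ hUₚ hAL c hc⟩
  intro r S
  rw [hNeq]
  exact smul_mem_imp_iff_map_of_injective _ hinj r S

end FromRoots

section Bookkeeping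

variable {R K Y : Type*} [CommRing R] [AddCommGroup K] [Module R K] [AddCommGroup Y] [Module R Y]

/-- Bookkeeping: if `S ⊓ N = P` then `S` is `r`-saturated on `N` iff `P` is `r`-saturated on `N`. -/
theorem smul_mem_imp_on_iff_of_inf_eq (r : R) (S N P : Submodule R Y) (h : S ⊓ N = P) :
    (∀ a ∈ N, r • a ∈ S → a ∈ S) ↔ (∀ a ∈ N, r • a ∈ P → a ∈ P) := by
  constructor
  · intro hs a ha hra
    have hra' : r • a ∈ S ⊓ N := by rw [h]; exact hra
    have haS : a ∈ S := hs a ha hra'.1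
    rw [← h]
    exact ⟨haS, ha⟩
  · intro hp a ha hra
    have hraP : r • a ∈ P := by rw [← h]; exact ⟨hra, N.smul_mem r ha⟩
    have haP : a ∈ P := hp a ha hraP
    rw [← h] at haP
    exact haP.1

/-- The bridged pair `(U ∘ d₁, d₁)` maps `S₀ × S₀` onto the same lattice as the geometric pair
`(d₁, dₚ)` (transpose convention): the change of coordinates `(x, z) ↦ (t • x + z, x)` of `K × K` is
unimodular and preserves `S₀ × S₀`. [cite: Wiles1995, §2] -/
theorem prod_map_coprod_convA_eq (t : R) (d₁ dₚ : K →ₗ[R] Y) (U : Y →ₗ[R] Y)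
    (hU₁ : ∀ x, U (d₁ x) = d₁ (t • x) + dₚ x) (S₀ : Submodule R K) :
    (S₀.prod S₀).map ((U ∘ₗ d₁).coprod d₁) = (S₀.prod S₀).map (d₁.coprod dₚ) := by
  apply le_antisymm
  · rintro _ ⟨⟨x, z⟩, hxz, rfl⟩
    obtain ⟨hx, hz⟩ := Submodule.mem_prod.mp hxz
    refine ⟨(t • x + z, x), Submodule.mem_prod.mpr ⟨S₀.add_mem (S₀.smul_mem t hx) hz, hx⟩, ?_⟩
    exact (coprod_convA_apply t d₁ dₚ U hU₁ x z).symm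
  · rintro _ ⟨⟨x, z⟩, hxz, rfl⟩
    obtain ⟨hx, hz⟩ := Submodule.mem_prod.mp hxz
    refine ⟨(z, x - t • z), Submodule.mem_prod.mpr ⟨hz, S₀.sub_mem hx (S₀.smul_mem t hz)⟩, ?_⟩
    exact (coprod_apply_eq_convA t d₁ dₚ U hU₁ x z).symm

end Bookkeeping

/-! ## Case (B2): `a_p(ρ̄) ≠ 0` — the two roots `u₀ ∈ 𝔪`, `u₁ ∈ 𝕋(M)_𝔪ˣ` -/

section CaseB2

variable {R K Y : Type*} [CommRing R] [AddCommGroup K] [Module R K] [AddCommGroup Y] [Module R Y]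

/-- **Case (B2) structure from Ribet's data.** From `U + W = d₁ ∘ a`, the swap, `a ∘ d₁ = t`,
`a ∘ dₚ = −(p+1)`, `W² = 1`, injectivity of `d₁.coprod dₚ` and the roots `u₀, u₁` (`u₁ − u₀`,
`u₀² − 1` units): the `U_p`-nilpotent part `ker(U − u₀)` EQUALS `range φ₀` for K115's transpose
intertwiner `φ₀ = u₀ • d₁ + dₚ`, `φ₀` is injective, `U = u₀` on it, and
`Y = ker(U − u₀) ⊕ ker((U − u₁)(U² − 1))`. (K118b on the bridged convention-(A) pair `(U ∘ d₁, d₁)` of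
K120; no finiteness, no idempotent, no Ihara.)
[cite: Ribet1990, Remark 3.9 (p. 447) and Prop. 3.7 (proof), pp. 445–446] [cite: Wiles1995, §2] -/
theorem upNilpotentPart_of_ribetData (t p u₀ u₁ : R) (hu₀ : u₀ * u₀ = t * u₀ - p)
    (hu₁ : u₁ * u₁ = t * u₁ - p) (hunit : IsUnit (u₁ - u₀)) (hu₀1 : IsUnit (u₀ * u₀ - 1))
    (d₁ dₚ : K →ₗ[R] Y) (a : Y →ₗ[R] K) (U W : Y →ₗ[R] Y)
    (hUW : ∀ y, U y + W y = d₁ (a y)) (hW₁ : ∀ x, W (d₁ x) = -(dₚ x)) (hWₚ : ∀ x, W (dₚ x) = -(d₁ x))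
    (ha₁ : ∀ x, a (d₁ x) = t • x) (haₚ : ∀ x, a (dₚ x) = -((p + 1) • x)) (hW2 : ∀ y, W (W y) = y)
    (hj : Function.Injective (d₁.coprod dₚ)) :
    LinearMap.ker (U - u₀ • 1) = LinearMap.range (u₀ • d₁ + dₚ)
    ∧ Function.Injective (u₀ • d₁ + dₚ)
    ∧ (∀ w ∈ LinearMap.ker (U - u₀ • 1), U w = u₀ • w)
    ∧ IsCompl (LinearMap.ker (U - u₀ • 1)) (LinearMap.ker ((U - u₁ • 1) * (U * U - 1))) := by
  obtain ⟨hU₁, hUₚ⟩ := transpose_convention_of_ribet t p d₁ dₚ a U W hUW hW₁ hWₚ ha₁ haₚ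
  obtain ⟨hA₁, hAₚ, hAL, -, -⟩ :=
    V64B_inputs_of_ribet_data t p d₁ dₚ a U W hUW hW₁ hWₚ ha₁ haₚ hW2
  have hjA : Function.Injective ((U ∘ₗ d₁).coprod d₁) :=
    (injective_coprod_convA_iff_of_transpose t d₁ dₚ U hU₁).mpr hj
  obtain ⟨hNeq, hinj, hUN, -, hcompl⟩ := upNilpotentPart_eq_range_intertwiner_of_roots t p u₀ u₁
    hu₀ hu₁ hunit hu₀1 (U ∘ₗ d₁) d₁ U hA₁ hAₚ hjA hAL
  have hφ : (U ∘ₗ d₁) + (u₀ - t) • d₁ = u₀ • d₁ + dₚ :=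
    LinearMap.ext (intertwiner_convA_eq_transpose t u₀ d₁ dₚ U hU₁)
  rw [hφ] at hNeq hinj
  exact ⟨hNeq, hinj, hUN, hcompl⟩

/-- **PROPOSITION V64-B, CASE (B2), AS ONE THEOREM.** Hypotheses: Ribet's data (`U + W = d₁ ∘ a`, the
swap, `a ∘ d₁ = t`, `a ∘ dₚ = −(p+1)`, `W² = 1`), injectivity of `d₁.coprod dₚ`, the roots `u₀, u₁` of
`X² − tX + p` with `u₁ − u₀` and `u₀² − 1` units, a `U`-stable lattice `S ≤ Y` (the two-prime old
lattice at level `pM`) and the old-lattice identification `S ⊓ ker(U − u₀) = φ₀(S₀)`,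
`φ₀ = u₀ • d₁ + dₚ`, `S₀ ≤ K` (the two-prime old lattice at level `M`). Conclusion:
`S` is `r`-SATURATED in `Y` ⟺ `S₀` is `r`-saturated in `K` ∧ `S` is `r`-saturated on
`ker((U − u₁)(U² − 1))` — i.e. T-V54 @ `(pM, 𝔪)` ⟺ T-V54 @ `(M, 𝔪)` ∧ T-V54 at the ordinary ideals.
[cite: Ribet1990, Remark 3.9 (p. 447) and Prop. 3.7 (proof), pp. 445–446] [cite: Wiles1995, §2] -/
theorem tv54_semistable_iff_minimal_caseB2 (t p u₀ u₁ : R) (hu₀ : u₀ * u₀ = t * u₀ - p)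
    (hu₁ : u₁ * u₁ = t * u₁ - p) (hunit : IsUnit (u₁ - u₀)) (hu₀1 : IsUnit (u₀ * u₀ - 1))
    (d₁ dₚ : K →ₗ[R] Y) (a : Y →ₗ[R] K) (U W : Y →ₗ[R] Y)
    (hUW : ∀ y, U y + W y = d₁ (a y)) (hW₁ : ∀ x, W (d₁ x) = -(dₚ x)) (hWₚ : ∀ x, W (dₚ x) = -(d₁ x))
    (ha₁ : ∀ x, a (d₁ x) = t • x) (haₚ : ∀ x, a (dₚ x) = -((p + 1) • x)) (hW2 : ∀ y, W (W y) = y)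
    (hj : Function.Injective (d₁.coprod dₚ))
    (S : Submodule R Y) (hS : ∀ s ∈ S, U s ∈ S) (S₀ : Submodule R K)
    (hident : S ⊓ LinearMap.ker (U - u₀ • 1) = S₀.map (u₀ • d₁ + dₚ)) (r : R) :
    (∀ y : Y, r • y ∈ S → y ∈ S) ↔
      (∀ x : K, r • x ∈ S₀ → x ∈ S₀)
      ∧ (∀ b ∈ LinearMap.ker ((U - u₁ • 1) * (U * U - 1)), r • b ∈ S → b ∈ S) := by
  obtain ⟨hU₁, hUₚ⟩ := transpose_convention_of_ribet t p d₁ dₚ a U W hUW hW₁ hWₚ ha₁ haₚ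
  obtain ⟨hA₁, hAₚ, hAL, -, -⟩ :=
    V64B_inputs_of_ribet_data t p d₁ dₚ a U W hUW hW₁ hWₚ ha₁ haₚ hW2
  have hjA : Function.Injective ((U ∘ₗ d₁).coprod d₁) :=
    (injective_coprod_convA_iff_of_transpose t d₁ dₚ U hU₁).mpr hj
  obtain ⟨-, -, -, htransfer, -⟩ := upNilpotentPart_eq_range_intertwiner_of_roots t p u₀ u₁
    hu₀ hu₁ hunit hu₀1 (U ∘ₗ d₁) d₁ U hA₁ hAₚ hjA hAL
  have hφ : (U ∘ₗ d₁) + (u₀ - t) • d₁ = u₀ • d₁ + dₚ :=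
    LinearMap.ext (intertwiner_convA_eq_transpose t u₀ d₁ dₚ U hU₁)
  rw [hφ] at htransfer
  -- the unit `c` of the projector `e₀ = c • (U − u₁)(U² − 1)`
  have hunit' : IsUnit (u₀ - u₁) := by rw [← neg_sub]; exact hunit.neg
  obtain ⟨c, hc⟩ := (hunit'.mul hu₀1).exists_left_inv
  -- saturation splits along `e₀` (K118d with K118a's pointwise facts)
  rw [tv54_split_caseB2 u₀ u₁ c U S hS
    (U_projector_apply t p u₀ u₁ hu₀ hu₁ hunit (U ∘ₗ d₁) d₁ U hA₁ hAₚ hAL c)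
    (cubic_apply_sub_projector t p u₀ u₁ hu₀ hu₁ hunit (U ∘ₗ d₁) d₁ U hA₁ hAₚ hAL c hc) r,
    smul_mem_imp_on_iff_of_inf_eq r S _ _ hident, ← htransfer r S₀]

end CaseB2

/-! ## Case (B1): `t² − (p+1)²` a unit (e.g. `a_p(ρ̄) = 0`) — `Y = j′(K × K) ⊕ ker(U² − 1)` -/

section CaseB1

variable {R K Y : Type*} [CommRing R] [AddCommGroup K] [Module R K] [AddCommGroup Y] [Module R Y]

/-- **Case (B1) structure from Ribet's data.** From Ribet's data, injectivity of `d₁.coprod dₚ` and one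
unit `d · (t² − (p+1)²) = 1`: the geometric `p`-old part `range(d₁.coprod dₚ)` EQUALS
`ker(U² − tU + p)` and `Y = ker(U² − tU + p) ⊕ ker(U² − 1)`. (K118c on the bridged pair; K120
`range_coprod_convA_eq_of_transpose`.)
[cite: Ribet1990, Remark 3.9 (p. 447) and Prop. 3.7 (proof), pp. 445–446] [cite: Wiles1995, §2] -/
theorem pOldPart_of_ribetData (t p d : R) (hd : d * (t * t - (p + 1) * (p + 1)) = 1)
    (d₁ dₚ : K →ₗ[R] Y) (a : Y →ₗ[R] K) (U W : Y →ₗ[R] Y)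
    (hUW : ∀ y, U y + W y = d₁ (a y)) (hW₁ : ∀ x, W (d₁ x) = -(dₚ x)) (hWₚ : ∀ x, W (dₚ x) = -(d₁ x))
    (ha₁ : ∀ x, a (d₁ x) = t • x) (haₚ : ∀ x, a (dₚ x) = -((p + 1) • x)) (hW2 : ∀ y, W (W y) = y)
    (hj : Function.Injective (d₁.coprod dₚ)) :
    LinearMap.range (d₁.coprod dₚ) = LinearMap.ker (U * U - t • U + p • 1)
    ∧ IsCompl (LinearMap.ker (U * U - t • U + p • 1)) (LinearMap.ker (U * U - 1)) := by
  obtain ⟨hU₁, hUₚ⟩ := transpose_convention_of_ribet t p d₁ dₚ a U W hUW hW₁ hWₚ ha₁ haₚ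
  obtain ⟨hA₁, hAₚ, hAL, -, -⟩ :=
    V64B_inputs_of_ribet_data t p d₁ dₚ a U W hUW hW₁ hWₚ ha₁ haₚ hW2
  have hjA : Function.Injective ((U ∘ₗ d₁).coprod d₁) :=
    (injective_coprod_convA_iff_of_transpose t d₁ dₚ U hU₁).mpr hj
  obtain ⟨hPeq, hcompl, -, -⟩ := pOldPart_caseB1 t p d hd (U ∘ₗ d₁) d₁ U hA₁ hAₚ hjA hAL
  rw [range_coprod_convA_eq_of_transpose t d₁ dₚ U hU₁] at hPeq
  exact ⟨hPeq, hcompl⟩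

/-- **PROPOSITION V64-B, CASE (B1), AS ONE THEOREM.** Hypotheses: Ribet's data, injectivity of
`d₁.coprod dₚ`, one unit `d · (t² − (p+1)²) = 1`, a `U`-stable lattice `S ≤ Y` and the old-lattice
identification `S ⊓ range(d₁.coprod dₚ) = (d₁.coprod dₚ)(S₀ × S₀)`. Conclusion:
`S` is `r`-SATURATED in `Y` ⟺ `S₀` is `r`-saturated in `K` ∧ `S` is `r`-saturated on `ker(U² − 1)` —
T-V54 @ `(pM, 𝔪)` ⟺ T-V54 @ `(M, 𝔪)` ∧ T-V54 on the `p`-new vectors at `𝔪`.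
[cite: Ribet1990, Remark 3.9 (p. 447) and Prop. 3.7 (proof), pp. 445–446] [cite: Wiles1995, §2] -/
theorem tv54_semistable_iff_minimal_caseB1 (t p d : R) (hd : d * (t * t - (p + 1) * (p + 1)) = 1)
    (d₁ dₚ : K →ₗ[R] Y) (a : Y →ₗ[R] K) (U W : Y →ₗ[R] Y)
    (hUW : ∀ y, U y + W y = d₁ (a y)) (hW₁ : ∀ x, W (d₁ x) = -(dₚ x)) (hWₚ : ∀ x, W (dₚ x) = -(d₁ x))
    (ha₁ : ∀ x, a (d₁ x) = t • x) (haₚ : ∀ x, a (dₚ x) = -((p + 1) • x)) (hW2 : ∀ y, W (W y) = y)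
    (hj : Function.Injective (d₁.coprod dₚ))
    (S : Submodule R Y) (hS : ∀ s ∈ S, U s ∈ S) (S₀ : Submodule R K)
    (hident : S ⊓ LinearMap.range (d₁.coprod dₚ) = (S₀.prod S₀).map (d₁.coprod dₚ)) (r : R) :
    (∀ y : Y, r • y ∈ S → y ∈ S) ↔
      (∀ x : K, r • x ∈ S₀ → x ∈ S₀)
      ∧ (∀ b ∈ LinearMap.ker (U * U - 1), r • b ∈ S → b ∈ S) := by
  obtain ⟨hU₁, hUₚ⟩ := transpose_convention_of_ribet t p d₁ dₚ a U W hUW hW₁ hWₚ ha₁ haₚ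
  obtain ⟨hA₁, hAₚ, hAL, -, -⟩ :=
    V64B_inputs_of_ribet_data t p d₁ dₚ a U W hUW hW₁ hWₚ ha₁ haₚ hW2
  have hjA : Function.Injective ((U ∘ₗ d₁).coprod d₁) :=
    (injective_coprod_convA_iff_of_transpose t d₁ dₚ U hU₁).mpr hj
  obtain ⟨hPeq, -, -, htransfer⟩ := pOldPart_caseB1 t p d hd (U ∘ₗ d₁) d₁ U hA₁ hAₚ hjA hAL
  have hrange := range_coprod_convA_eq_of_transpose t d₁ dₚ U hU₁
  -- saturation splits along the old projector `e₁` (K118d with K118c's pointwise facts)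
  rw [tv54_split_caseB1 t p d U S hS
    (quadratic_apply_oldProjector t p d (U ∘ₗ d₁) d₁ U hA₁ hAₚ hAL)
    (sq_sub_one_apply_sub_oldProjector t p d hd (U ∘ₗ d₁) d₁ U hA₁ hAₚ hAL) r,
    ← hPeq, hrange, smul_mem_imp_on_iff_of_inf_eq r S _ _ hident, htransfer r S₀, hrange,
    prod_map_coprod_convA_eq t d₁ dₚ U hU₁ S₀]

end CaseB1

end Summit.BirchSwinnertonDyer.Rank1Residual.LevelLowering
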